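import Summits.AtomisticToContinuum.Crystallization.Theorems.ChargedEnergyGapStencilTuple
import HarnessLib

/-!
# ChargedEnergyGap · NODE 92 «StencilChart» — the realisability ROWS of the (D¹) [CELL-LP] instrument, certified

decomp-a2c lens-3 g90 (L2 of the Lean certificate path of memo CELLLP-SPEC-g90 §7; imports NODE 91 «StencilTuple»).

NODE 91 reduced (D¹) `SoloFeetLawQ` to (T¹) `StencilTupleLawQ`: a law over REALISABLE depth tuples `dt` on the standard seven-point stencil,
realisability being «every stencil point `p` has a foot `s` with `dist (stdPt ρ p) s = dt p` and `dt q ≤ dist (stdPt ρ q) s` for all stencil `q`».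
This node removes the last existential over `ℝ³`-points in favour of the form the census LP actually uses (SPEC §1 (*)): writing the foot as
`s = stdPt ρ p + (dt p) • u` with a UNIT VECTOR `u`, realisability of `p` against `q` is the ROW
  `2 · dt p · ⟪stdPt ρ q − stdPt ρ p, u⟫ ≤ ‖stdPt ρ q − stdPt ρ p‖² + (dt p)² − (dt q)²`            (`realisRow`)
— linear in `u`, quadratic in `dt` — and in coordinates `⟪stdPt ρ q − stdPt ρ p, u⟫ = ρ Σₖ (qₖ − pₖ) uₖ`, `‖stdPt ρ q − stdPt ρ p‖² = ρ² Σₖ (qₖ − pₖ)²`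
(`realisRow_iff_coord`).  PROVED: for tuples positive on the stencil, `IsStencilRealisable ρ dt ↔ IsChartRealisable ρ dt`
(`isStencilRealisable_iff_chart`); realisable tuples are non-negative (`isStencilRealisable_nonneg`) and tuple-admissible tuples are
positive on the stencil when `0 < ρ` (`isTupleHole_pos`: vertices `≥ 93.5` from the depth row, centre `> 0` from max-kink `≥ 1`); hence for
`0 < ρlo` the CHART LAW (T¹ᶜ) `StencilChartLawQ` (rows + positivity instead of feet) is EQUIVALENT to (T¹) and to (D¹)
(`stencilTupleLaw_iff_chartLaw`, `soloFeetLawQ_iff_chartLaw`).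

[EQUIV (coordinate chart of NODE 91's translation; no estimate moved, no constant changed) · (T¹ᶜ) UNDECIDED(test = (D¹)) · INSTRUMENTABLE: (T¹ᶜ)
is LITERALLY the feasible set of the cell LP of SPEC §2 (rows R-real) intersected with the admissibility rows, over which `feetHoleCost − domCapK` is
to be bounded `≤ 0`.] -/

noncomputable section
open scoped Classical
open Literature.MathematicalPhysics.StatisticalMechanics Literature.Geometry.DiscreteGeometry
open Summit.AtomisticToContinuum.Crystallization.Theses.PricedLinkCensus
open Summit.AtomisticToContinuum.Crystallization.Theorems.ChargedEnergyGapNegative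

namespace Summit.AtomisticToContinuum.Crystallization.Theorems.ChargedEnergyGapChartDial

/-! ## §92.1 Coordinates of the standard lattice -/
section Coordinates

/-- [formal bookkeeping] -/
theorem stdPt_apply (ρ : ℝ) (z : Fin 3 → ℤ) (k : Fin 3) : stdPt ρ z k = (z k : ℝ) * ρ := by
  rw [stdPt_eq_sum]
  unfold stdFrame
  simp [EuclideanSpace.basisFun_apply, Fin.sum_univ_three]
  fin_cases k <;> simp

/-- [formal bookkeeping] -/
theorem stdPt_sub_apply (ρ : ℝ) (p q : Fin 3 → ℤ) (k : Fin 3) : (stdPt ρ q - stdPt ρ p) k = ((q k - p k : ℤ) : ℝ) * ρ := by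
  rw [PiLp.sub_apply, stdPt_apply, stdPt_apply]
  push_cast
  ring

/-- ★ [formal bookkeeping] `⟪P_q − P_p, u⟫ = ρ Σₖ (qₖ − pₖ) uₖ`. -/
theorem inner_stdPt_sub (ρ : ℝ) (p q : Fin 3 → ℤ) (u : E3) :
    inner ℝ (stdPt ρ q - stdPt ρ p) u = ρ * ∑ k, ((q k - p k : ℤ) : ℝ) * u k := by
  rw [PiLp.inner_apply, Finset.mul_sum]
  refine Finset.sum_congr rfl fun k _ => ?_
  rw [stdPt_sub_apply]
  simp
  ring

/-- ★ [formal bookkeeping] `‖P_q − P_p‖² = ρ² Σₖ (qₖ − pₖ)²`. -/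
theorem norm_stdPt_sub_sq (ρ : ℝ) (p q : Fin 3 → ℤ) :
    ‖stdPt ρ q - stdPt ρ p‖ ^ 2 = ρ ^ 2 * ∑ k, ((q k - p k : ℤ) : ℝ) ^ 2 := by
  rw [EuclideanSpace.real_norm_sq_eq, Finset.mul_sum]
  refine Finset.sum_congr rfl fun k _ => ?_
  rw [stdPt_sub_apply]
  ring

end Coordinates

/-! ## §92.2 The realisability rows -/
section Rows

/-- ★★ The REALISABILITY ROW of the ordered stencil pair `(p, q)` for the foot direction `u` of `p`:
`2 · dt p · ⟪P_q − P_p, u⟫ ≤ ‖P_q − P_p‖² + (dt p)² − (dt q)²` (`P = stdPt ρ`).  With `s = P_p + (dt p) u`, `‖u‖ = 1`, it says `dt q ≤ dist P_q s`. -/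
def realisRow (ρ : ℝ) (dt : (Fin 3 → ℤ) → ℝ) (p q : Fin 3 → ℤ) (u : E3) : Prop :=
  2 * dt p * inner ℝ (stdPt ρ q - stdPt ρ p) u ≤ ‖stdPt ρ q - stdPt ρ p‖ ^ 2 + dt p ^ 2 - dt q ^ 2

/-- ★ The row in LP coordinates. [formal bookkeeping] -/
theorem realisRow_iff_coord (ρ : ℝ) (dt : (Fin 3 → ℤ) → ℝ) (p q : Fin 3 → ℤ) (u : E3) :
    realisRow ρ dt p q u ↔
      2 * dt p * (ρ * ∑ k, ((q k - p k : ℤ) : ℝ) * u k) ≤ ρ ^ 2 * (∑ k, ((q k - p k : ℤ) : ℝ) ^ 2) + dt p ^ 2 - dt q ^ 2 := by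
  unfold realisRow
  rw [inner_stdPt_sub, norm_stdPt_sub_sq]

/-- ★★ **CHART REALISABILITY**: every stencil point has a unit foot DIRECTION satisfying its six rows (the row `q = p` is `0 ≤ 0`). -/
def IsChartRealisable (ρ : ℝ) (dt : (Fin 3 → ℤ) → ℝ) : Prop :=
  ∀ p ∈ stencil 0, ∃ u : E3, ‖u‖ = 1 ∧ ∀ q ∈ stencil 0, realisRow ρ dt p q u

/-- [formal bookkeeping] the foot/direction dictionary: `‖(P_q − P_p) − t • u‖² = ‖P_q − P_p‖² − 2 t ⟪P_q − P_p, u⟫ + t²` for a unit `u`. -/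
theorem norm_sub_smul_unit_sq (a u : E3) (hu : ‖u‖ = 1) (t : ℝ) :
    ‖a - t • u‖ ^ 2 = ‖a‖ ^ 2 - 2 * t * inner ℝ a u + t ^ 2 := by
  rw [norm_sub_sq_real, real_inner_smul_right, norm_smul, hu, mul_one, Real.norm_eq_abs, sq_abs]
  ring

/-- ★ Realisable tuples are non-negative on the stencil. [formal bookkeeping] -/
theorem isStencilRealisable_nonneg {ρ : ℝ} {dt : (Fin 3 → ℤ) → ℝ} (h : IsStencilRealisable ρ dt) : ∀ p ∈ stencil 0, 0 ≤ dt p := by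
  intro p hp
  obtain ⟨s, hs, -⟩ := h p hp
  rw [← hs]
  exact dist_nonneg

/-- ★★★ **THE CHART (PROVED)**: for a tuple positive on the stencil, feet ⟺ unit directions satisfying the rows. -/
theorem isStencilRealisable_iff_chart {ρ : ℝ} {dt : (Fin 3 → ℤ) → ℝ} (hpos : ∀ p ∈ stencil 0, 0 < dt p) :
    IsStencilRealisable ρ dt ↔ IsChartRealisable ρ dt := by
  constructor
  · intro h p hp
    obtain ⟨s, hs, hq⟩ := h p hp
    have hp0 : 0 < dt p := hpos p hp
    refine ⟨(dt p)⁻¹ • (s - stdPt ρ p), ?_, fun q hq' => ?_⟩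
    · rw [norm_smul, norm_inv, Real.norm_eq_abs, abs_of_pos hp0, ← dist_eq_norm, dist_comm, hs, inv_mul_cancel₀ hp0.ne']
    · have hu1 : ‖(dt p)⁻¹ • (s - stdPt ρ p)‖ = 1 := by
        rw [norm_smul, norm_inv, Real.norm_eq_abs, abs_of_pos hp0, ← dist_eq_norm, dist_comm, hs, inv_mul_cancel₀ hp0.ne']
      have hsq : dt q ^ 2 ≤ ‖(stdPt ρ q - stdPt ρ p) - dt p • ((dt p)⁻¹ • (s - stdPt ρ p))‖ ^ 2 := by
        have hfoot : (stdPt ρ q - stdPt ρ p) - dt p • ((dt p)⁻¹ • (s - stdPt ρ p)) = stdPt ρ q - s := by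
          rw [smul_smul, mul_inv_cancel₀ hp0.ne', one_smul]
          abel
        rw [hfoot, ← dist_eq_norm]
        have h0 : 0 ≤ dt q := (hpos q hq').le
        have h1 : dt q ≤ dist (stdPt ρ q) s := hq q hq'
        nlinarith
      unfold realisRow
      rw [norm_sub_smul_unit_sq _ _ hu1] at hsq
      linarith
  · intro h p hp
    obtain ⟨u, hu, hrow⟩ := h p hp
    have hp0 : 0 < dt p := hpos p hp
    refine ⟨stdPt ρ p + dt p • u, ?_, fun q hq' => ?_⟩
    · rw [dist_eq_norm, sub_add_eq_sub_sub, sub_self, zero_sub, norm_neg, norm_smul, hu, mul_one, Real.norm_eq_abs, abs_of_pos hp0]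
    · have hsq : dt q ^ 2 ≤ dist (stdPt ρ q) (stdPt ρ p + dt p • u) ^ 2 := by
        rw [dist_eq_norm, ← sub_sub, norm_sub_smul_unit_sq _ _ hu]
        have := hrow q hq'
        unfold realisRow at this
        linarith
      exact (le_abs_self _).trans (abs_le_of_sq_le_sq hsq dist_nonneg)

end Rows

/-! ## §92.3 Positivity from admissibility, and the chart law -/
section ChartLaw

/-- [formal bookkeeping] membership in the standard stencil. -/
theorem mem_stencil_zero_iff (p : Fin 3 → ℤ) : p ∈ stencil 0 ↔ p = 0 ∨ ∃ u, p = holeVertex 0 u := by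
  unfold stencil
  simp only [Finset.mem_insert, Finset.mem_image, Finset.mem_univ, true_and]
  exact or_congr Iff.rfl ⟨fun ⟨u, hu⟩ => ⟨u, hu.symm⟩, fun ⟨u, hu⟩ => ⟨u, hu.symm⟩⟩

/-- ★ **POSITIVITY (PROVED)**: a tuple-admissible tuple is positive on the stencil when `0 < ρ` (no sign hypothesis needed) — the six vertices are
`≥ 93.5` (depth row `≥ 1`) and the centre satisfies `2 dt 0 ≥ dt(eₐ) + dt(−eₐ) + ρ` on the max-kink axis (kink column `≥ 2`, i.e. max-kink `≥ 1`). -/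
theorem isTupleHole_pos {dK ρ : ℝ} (hρ : 0 < ρ) {dt : (Fin 3 → ℤ) → ℝ} (h : IsTupleHole dK ρ dt) :
    ∀ p ∈ stencil 0, 0 < dt p := by
  obtain ⟨hrow, hcol, -, -⟩ := h
  have hmin : 187 / 2 ≤ hDepthMin dt 0 := by
    by_contra hlt
    rw [not_le] at hlt
    unfold capKRow at hrow
    rw [if_pos hlt] at hrow
    exact absurd hrow (by norm_num)
  have hvert : ∀ u, 187 / 2 ≤ dt (holeVertex 0 u) := fun u =>
    hmin.trans (Finset.inf'_le _ (Finset.mem_univ u))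
  have hkink : 1 ≤ hMaxKink ρ dt 0 := by
    by_contra hlt
    rw [not_le] at hlt
    unfold capKCol at hcol
    by_cases h12 : hMaxKink ρ dt 0 < 1 / 2
    · rw [if_pos h12] at hcol
      exact absurd hcol (by norm_num)
    · rw [if_neg h12, if_pos hlt] at hcol
      exact absurd hcol (by norm_num)
  have hcentre : 0 < dt 0 := by
    obtain ⟨a, -, ha⟩ := Finset.exists_mem_eq_sup' Finset.univ_nonempty (hKink ρ dt 0)
    have hk : 1 ≤ hKink ρ dt 0 a := by
      have : hMaxKink ρ dt 0 = hKink ρ dt 0 a := ha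
      rw [← this]
      exact hkink
    unfold hKink at hk
    rw [le_div_iff₀ hρ] at hk
    have h1 := hvert (a, true)
    have h2 := hvert (a, false)
    rw [fc_holeVertex_true] at h1
    rw [fc_holeVertex_false] at h2
    linarith
  intro p hp
  rcases (mem_stencil_zero_iff p).1 hp with rfl | ⟨u, rfl⟩
  · exact hcentre
  · exact lt_of_lt_of_le (by norm_num) (hvert u)

/-- ★★★ **(T¹ᶜ) THE STENCIL CHART LAW** — (T¹) with feet replaced by unit directions and rows: for every `ρ ∈ [ρlo, ρhi]` and every tuple `dt`
POSITIVE on the stencil, CHART-REALISABLE and TUPLE-ADMISSIBLE, `feetHoleCost ϱ τ ρ dt 0 ≤ domCapK unit ϱ τ ρ (chargeDepth ρ dt 0)`.  This is the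
statement the cell LP of SPEC §2 bounds: its feasible set is `{(dt, u_p)} :` rows R-real (`realisRow`, linear in `u`, via `realisRow_iff_coord`)
`∧ ‖u_p‖ = 1 ∧` admissibility, its objective `feetHoleCost − domCapK ∘ chargeDepth`. -/
def StencilChartLawQ (dK unit ϱ τ ρlo ρhi : ℝ) : Prop :=
  ∀ ρ : ℝ, ρlo ≤ ρ → ρ ≤ ρhi → ∀ dt : (Fin 3 → ℤ) → ℝ, (∀ p ∈ stencil 0, 0 < dt p) → IsChartRealisable ρ dt → IsTupleHole dK ρ dt →
    feetHoleCost ϱ τ ρ dt 0 ≤ domCapK unit ϱ τ ρ (chargeDepth ρ dt 0)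

/-- ★★ (T¹ᶜ) ⟹ (T¹) for `0 < ρlo` (PROVED) — the census direction. -/
theorem stencilTupleLaw_of_chartLaw {dK unit ϱ τ ρlo ρhi : ℝ} (hρ : 0 < ρlo) (h : StencilChartLawQ dK unit ϱ τ ρlo ρhi) :
    StencilTupleLawQ dK unit ϱ τ ρlo ρhi := by
  intro ρ h₁ h₂ dt hreal hhole
  have hpos := isTupleHole_pos (hρ.trans_le h₁) hhole
  exact h ρ h₁ h₂ dt hpos ((isStencilRealisable_iff_chart hpos).1 hreal) hhole

/-- ★★ (T¹) ⟹ (T¹ᶜ) (PROVED). -/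
theorem chartLaw_of_stencilTupleLaw {dK unit ϱ τ ρlo ρhi : ℝ} (h : StencilTupleLawQ dK unit ϱ τ ρlo ρhi) :
    StencilChartLawQ dK unit ϱ τ ρlo ρhi :=
  fun ρ h₁ h₂ dt hpos hchart hhole => h ρ h₁ h₂ dt ((isStencilRealisable_iff_chart hpos).2 hchart) hhole

/-- ★★★ **(T¹) ⟺ (T¹ᶜ)** for `0 < ρlo` (PROVED). -/
theorem stencilTupleLaw_iff_chartLaw {dK unit ϱ τ ρlo ρhi : ℝ} (hρ : 0 < ρlo) :
    StencilTupleLawQ dK unit ϱ τ ρlo ρhi ↔ StencilChartLawQ dK unit ϱ τ ρlo ρhi :=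
  ⟨chartLaw_of_stencilTupleLaw, stencilTupleLaw_of_chartLaw hρ⟩

/-- ★★★ **(D¹) ⟺ (T¹ᶜ)** for `0 < ρlo` (PROVED): the solo feet law IS the chart law — the census object in LP coordinates. -/
theorem soloFeetLawQ_iff_chartLaw {dK unit ϱ τ ρlo ρhi : ℝ} (hρ : 0 < ρlo) :
    SoloFeetLawQ dK unit ϱ τ ρlo ρhi ↔ StencilChartLawQ dK unit ϱ τ ρlo ρhi :=
  (soloFeetLawQ_iff_stencilTupleLaw dK unit ϱ τ ρlo ρhi).trans (stencilTupleLaw_iff_chartLaw hρ)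

/-- ★ At the designate constants of `chargedEnergyGap_of_feetLaw_numerics` (`ρlo = 679/1000 > 0`). -/
theorem soloFeetLawQ_designate_of_chartLaw (h : StencilChartLawQ 130 (1/60000000) 160 (3/100) (679/1000) (691/1000)) :
    SoloFeetLawQ 130 (1/60000000) 160 (3/100) (679/1000) (691/1000) :=
  (soloFeetLawQ_iff_chartLaw (by norm_num)).2 h

end ChartLaw

end Summit.AtomisticToContinuum.Crystallization.Theorems.ChargedEnergyGapChartDial

end
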